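import Literature.Topology.FourManifolds.MapSmoothing
import Mathlib.Topology.Homotopy.Basic

/-!
# Nearby maps into a compact manifold are homotopic (through a normal retraction)

Topic `Literature/Topology/FourManifolds` (infrastructure for the fact seat
`provefact-Literature.Geometry.Riemannian.LawsonMichelsohn1984_surrounding`: Wall's form of the
trading of `1`-handles keeps track of the homotopy class of Milnor's ideal circle through the
smoothing and general-position steps of Lemma 8.3 / Lemma 6.12, which control maps only through
`MapsTo`/`EqOn` conditions; this file turns such control into homotopies).  Everything here is
**proved**; no definitions.

**The statement** (`exists_cover_homotopic_of_mapsTo`).  For a compact `C^∞` manifold `V`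
(Hausdorff, boundaryless model `𝓡 n`) there is an open cover `U : V → Set V`, `y ∈ U y`, such
that: any two continuous maps `f g : X → V` from any topological space which are **`U`-close** —
every point `u` has `f u, g u ∈ U y` for some `y` — are homotopic; moreover the homotopy is
stationary where `f = g` (`rel` the coincidence set is not asserted, only that `H (s, u) = f u`
whenever `f u = g u`).

**Proof** (Bredon, *Topology and Geometry* (1993), II Cor. 11.9 / Hatcher Prop. 0.16 style, via
an embedding): embed `V` in `ℝᴺ` (Mathlib's `exists_embedding_euclidean_of_compact`), take the
smooth normal retraction `r` of a tube `T ⊇ e(V)` (`exists_normalRetraction`,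
`NormalRetraction.lean`) and `δ > 0` with the closed `δ`-thickening of `e(V)` inside `T`
(`IsCompact.exists_cthickening_subset_open`); let `U y = e⁻¹(B(e y, δ/2))`.  For `U`-close `f`,
`g` the segment from `e (f u)` to `e (g u)` has length `< δ` and stays in `T`, so
`H (s, u) = r ((1 - s) e (f u) + s e (g u))` is a homotopy from `f` to `g` in `V`.

## References

* G. E. Bredon, *Topology and Geometry*, GTM 139 (1993), Ch. II, Thm. 11.14 / Cor. 11.9
  (tubular neighbourhoods, nearby maps are homotopic). [folklore]
* J. Milnor, *Lectures on the h-cobordism theorem* (1965), Lemma 6.12 (PDF p. 42: "`g ≃ f`").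
  [MilnorHCobordism1965]
-/

open scoped Manifold ContDiff Topology
open Set Function Filter Metric

noncomputable section

namespace Literature.Topology.FourManifolds

universe u

/-- **Nearby maps into a compact manifold are homotopic.**  There is an open cover
`U : V → Set V` (`y ∈ U y`) of the compact boundaryless `C^∞` manifold `V` such that any two
continuous maps `f g : X → V` with `f u, g u ∈ U (y u)` for every `u` are homotopic, by a homotopy
which does not move the points where `f` and `g` agree.  Proof through a Whitney embedding
`e : V → ℝᴺ` and the normal retraction `r` of a tube around `e(V)`:
`H (s, u) = r ((1 - s) e (f u) + s e (g u))`. [folklore] -/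
theorem exists_cover_homotopic_of_mapsTo {n : ℕ} (V : Type u) [TopologicalSpace V] [T2Space V]
    [CompactSpace V] [ChartedSpace (EuclideanSpace ℝ (Fin n)) V] [IsManifold (𝓡 n) ∞ V] :
    ∃ U : V → Set V, (∀ y, IsOpen (U y)) ∧ (∀ y, y ∈ U y) ∧
      ∀ {X : Type*} [TopologicalSpace X] (f g : C(X, V)),
        (∀ u, ∃ y, f u ∈ U y ∧ g u ∈ U y) →
          ∃ H : f.Homotopy g, ∀ s u, f u = g u → H (s, u) = f u := by
  rcases isEmpty_or_nonempty V with hV | hV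
  · refine ⟨fun _ => univ, fun _ => isOpen_univ, fun y => (IsEmpty.false y).elim, ?_⟩
    intro X _ f g _
    rcases isEmpty_or_nonempty X with hX | ⟨⟨u⟩⟩
    · refine ⟨{ toFun := fun p => f p.2
                continuous_toFun := f.continuous.comp continuous_snd
                map_zero_left := fun u => rfl
                map_one_left := fun u => (IsEmpty.false u).elim }, fun s u => (IsEmpty.false u).elim⟩
    · exact (IsEmpty.false (f u)).elim
  -- ### Whitney embedding of `V` and a smooth normal retraction
  obtain ⟨N, e, he, hemb, hinj⟩ := exists_embedding_euclidean_of_compact (I := 𝓡 n) (M := V)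
  obtain ⟨ε, hε, hTopen, hr, hre⟩ := exists_normalRetraction (I := 𝓡 n) he hemb.injective hinj
  set T := normalTube (𝓡 n) e ε with hTdef
  set r := normalRetraction (𝓡 n) e ε with hrdef
  have hreT : ∀ y : V, e y ∈ T ∧ r (e y) = y := fun y => by
    simpa [hTdef, hrdef] using hre y 0 (Submodule.zero_mem _) (by simpa using hε)
  have hec : Continuous e := he.continuous
  have hrc : ContinuousOn r T := hr.continuousOn
  -- ### margin: the closed `δ`-thickening of `e(V)` lies in the tube
  obtain ⟨δ, hδ, hδT⟩ := (isCompact_range hec).exists_cthickening_subset_open hTopen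
    (range_subset_iff.2 fun y => (hreT y).1)
  -- ### the cover
  refine ⟨fun y => e ⁻¹' ball (e y) (δ / 2), fun y => isOpen_ball.preimage hec,
    fun y => by simp [hδ], ?_⟩
  intro X _ f g hclose
  -- the segment from `e (f u)` to `e (g u)` stays in the tube
  have hdist : ∀ u, dist (e (f u)) (e (g u)) < δ := fun u => by
    obtain ⟨y, hfy, hgy⟩ := hclose u
    have h1 : dist (e (f u)) (e y) < δ / 2 := hfy
    have h2 : dist (e (g u)) (e y) < δ / 2 := hgy
    calc dist (e (f u)) (e (g u)) ≤ dist (e (f u)) (e y) + dist (e (g u)) (e y) :=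
          dist_triangle_right _ _ _
      _ < δ := by linarith
  set seg : unitInterval × X → EuclideanSpace ℝ (Fin N) := fun p =>
    (1 - (p.1 : ℝ)) • e (f p.2) + (p.1 : ℝ) • e (g p.2) with hseg
  have hsegc : Continuous seg := by
    refine ((continuous_const.sub (continuous_subtype_val.comp continuous_fst)).smul
      (hec.comp (f.continuous.comp continuous_snd))).add
      ((continuous_subtype_val.comp continuous_fst).smul (hec.comp (g.continuous.comp
        continuous_snd)))
  have hsegT : ∀ p, seg p ∈ T := fun p => by
    refine hδT (Metric.mem_cthickening_of_dist_le _ (e (f p.2)) _ _ ⟨f p.2, rfl⟩ ?_)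
    have hs0 : 0 ≤ (p.1 : ℝ) := p.1.2.1
    have hs1 : (p.1 : ℝ) ≤ 1 := p.1.2.2
    have : seg p - e (f p.2) = (p.1 : ℝ) • (e (g p.2) - e (f p.2)) := by
      simp only [hseg, smul_sub, sub_smul, one_smul]; abel
    rw [dist_eq_norm, this, norm_smul, Real.norm_eq_abs, abs_of_nonneg hs0]
    have hd : ‖e (g p.2) - e (f p.2)‖ < δ := by rw [← dist_eq_norm, dist_comm]; exact hdist p.2
    nlinarith [norm_nonneg (e (g p.2) - e (f p.2))]
  have hHc : Continuous fun p : unitInterval × X => r (seg p) :=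
    hrc.comp_continuous hsegc hsegT
  refine ⟨{ toFun := fun p => r (seg p)
            continuous_toFun := hHc
            map_zero_left := fun u => ?_
            map_one_left := fun u => ?_ }, fun s u hfg => ?_⟩
  · show r (seg (0, u)) = f u
    have : seg (0, u) = e (f u) := by simp [hseg]
    rw [this]; exact (hreT (f u)).2
  · show r (seg (1, u)) = g u
    have : seg (1, u) = e (g u) := by simp [hseg]
    rw [this]; exact (hreT (g u)).2
  · show r (seg (s, u)) = f u
    have : seg (s, u) = e (f u) := by
      simp only [hseg, hfg]
      rw [← add_smul, sub_add_cancel, one_smul]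
    rw [this]; exact (hreT (f u)).2

/-- **`U`-close maps are homotopic** — the cover of `exists_cover_homotopic_of_mapsTo` used with
a finite family of compact sets: if `C i` cover `X`, each `C i` is mapped by both `f` and `g`
into a member `U (y i)` of the cover, then `f` and `g` are homotopic.  (This is the form of
closeness delivered by the `MapsTo` clauses of the smoothing theorem
`exists_contMDiff_eqOn_mapsTo` and the general-position theorem
`exists_isSmoothEmbedding_of_stagesGoodOn_core`.) [folklore] -/
theorem homotopic_of_mapsTo_cover {V : Type u} [TopologicalSpace V] {U : V → Set V} {X : Type*}
    [TopologicalSpace X]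
    (hU : ∀ (f g : C(X, V)),
      (∀ u, ∃ y, f u ∈ U y ∧ g u ∈ U y) → ∃ H : f.Homotopy g, ∀ s u, f u = g u → H (s, u) = f u)
    {ι : Type*} {C : ι → Set X} (hC : (⋃ i, C i) = univ)
    (y : ι → V) (f g : C(X, V)) (hf : ∀ i, MapsTo f (C i) (U (y i)))
    (hg : ∀ i, MapsTo g (C i) (U (y i))) : f.Homotopic g := by
  obtain ⟨H, -⟩ := hU f g fun u => by
    have hu : u ∈ ⋃ i, C i := by rw [hC]; trivial
    obtain ⟨i, hi⟩ := mem_iUnion.1 hu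
    exact ⟨y i, hf i hi, hg i hi⟩
  exact ⟨H⟩

end Literature.Topology.FourManifolds

end
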